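import Summits.BirchSwinnertonDyer.BirchSwinnertonDyer.Theorems.Rank1ResidualX9CMPartner
import Literature.NumberTheory.EllipticCurves.Rank1Residual.X9SplitPrime
import HarnessLib

/-!
# Route `SmallImageMuTransfer` (rung K6, leaf `BSDpOnClassX9`), crux `AnalyticMuZeroX9NoCMPartner`:
# the dihedral branch at EVERY `p ≥ 5` — `ρ̄_{E,p} ≅ Ind_M χ̄` with `p` split in `M`
# (KERNEL, unconditional; the `5Ns` pairs included)

HONEST FRAMING (cell `b2b-bsdres`, X9 prover lineage; verbatim): the cell deletes COMBINATION-SHAPED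
residual classes of the rank-≤1 BSD formula from PUBLISHED theorems only and TYPES the
construction-shaped remainder; this is not "finishing BSD".  Nothing below asserts anything about
any curve beyond what the kernel proves; class X9 stays TYPED at class level; no pair, count, mark or
tier word moves.  Helper file (`--supports stmt-BirchSwinnertonDyer-19235 --as helper`): it closes
no stub and no item; it unpacks the HYPOTHESIS of a registered stub.

The registered BC3 skeleton of the crux `AnalyticMuZeroX9NoCMPartner` (stmt-BirchSwinnertonDyer-19235,
cell `bsd-smallim`; sha16 05f45d2aa39320d7) splits on the image-shape dichotomy in a frame `(Φ, e)`
of `E[p]`, `G = Φ(ρ̄_{E,p}(Γ_ℚ))`: `stub_dihedral_noCM` carries the pairs with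
`∃ P, G ≤ N(P (* 0; 0 *) P⁻¹) ∧ ¬ G ≤ P (* 0; 0 *) P⁻¹`, `stub_exceptional_noCM` the others (which
are `p = 5`, projective image `𝔖₄`: `SmallImageMuTransferAnalyticMuZeroX9NoCMPartnerExceptionalS4`).
The line card's plan for the dihedral branch ("`ρ̄ ≅ Ind_M χ̄` is induced from a quadratic field
`M` (`ClassX9.exists_index_two_subgroup`); for `M` imaginary (`p` split in `M`, which good-ordinary
forces) the weight-2 CM newforms `θ_ψ` … are modular `μ`-partners inside the Hida family") quotes
this lineage's `p ≥ 7` theorems, where the split Cartan subgroup is PRODUCED by Serre's Prop. 17.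
At `p = 5` Prop. 17 is silent, but the dihedral stub is GIVEN its split Cartan subgroup `P` — and
for a given normalised `P` everything else is already in the tree at every `p ≥ 5`.  This file
packages it over the route's predicate `Rank1Residual.ClassX9`:

* `ClassX9.index_two_subgroup_split_of_splitCartan_normalizer` — for an X9 pair `(W, p)` (any
  `p`), a frame, and a split Cartan subgroup `C = P (* 0; 0 *) P⁻¹` with `G ≤ N(C)`, `G ⊄ C`
  (= the hypothesis of `stub_dihedral_noCM`): the subgroup `U = ρ̄⁻¹(Φ⁻¹(C)) ≤ Γ_ℚ` is open of
  index `2` (`ρ̄_{E,p} ≅ Ind_M^ℚ χ̄` for the quadratic field `M` of `U`), contains the decomposition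
  group of every prime of `ℤ̄` above `p` (**`p` SPLITS in `M`**; Serre §1.11 + Prop. 14 + Prop. 15,
  tree `ClassX9.stabilizer_le_comap_splitCartan`, X9 gen 4) and the inertia group of every prime
  above a good prime (`M` is unramified outside the bad primes; `inertia_le_comap_cartan`, and at
  `p` itself `I_𝔓 ≤ D_𝔓`).  Inputs: `index_comap_cartan_eq_two`, `isOpen_comap_cartan`
  (`SerreOpenImageNormalizerCaseProofs`), `Ideal.inertia_le_decompositionSubgroup`.
* `ClassX9.index_two_subgroup_split_of_splitCartan_normalizer_five` — the `p = 5` instance spelled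
  out (the `5Ns` pairs of the census: 130 with `r_an ≤ 1`, `N < 5·10⁵`; `M` imaginary for all but
  `74849d1`, `74849f1` — gen-4 sieve, EVIDENCE not used here).

No new definition, no named fact, no `sorry`; axioms standard.  (X9 prover GEN 40, 2026-08-26.)

## References

* [Serre1972] J.-P. Serre, *Propriétés galoisiennes des points d'ordre fini des courbes
  elliptiques*, Invent. Math. 15 (1972) 259–331: §1.11 Cor. to Prop. 11; §2.2 Prop. 14; §2.4
  Prop. 15; §4.2 c), Lemme 2.
-/

-- the summit and its single problem are both named `BirchSwinnertonDyer` (registry layout D-0017)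
set_option linter.dupNamespace false

set_option autoImplicit false

noncomputable section

open scoped Classical MatrixGroups NumberField
open Matrix WeierstrassCurve Field IsDedekindDomain NumberField
open Literature.NumberTheory.GaloisRepresentations
  Literature.NumberTheory.GaloisRepresentations.Serre1972

namespace Summit.BirchSwinnertonDyer.BirchSwinnertonDyer.Rank1Residual

section ClassLevel

variable (W : WeierstrassCurve ℚ) [W.IsElliptic] [W.IsGloballyMinimal] (p : ℕ) [Fact p.Prime]
  (Φ : Multiplicative (AddAut (geomTorsion W p)) ≃* GL (Fin 2) (ZMod p))
  (e : geomTorsion W p ≃+ (Fin 2 → ZMod p))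
  (he : ∀ (g : Multiplicative (AddAut (geomTorsion W p))) (x : geomTorsion W p),
    e (Multiplicative.toAdd g x) =
      ((Φ g : GL (Fin 2) (ZMod p)) : Matrix (Fin 2) (Fin 2) (ZMod p)) *ᵥ e x)

include he

/-- **X9, dihedral branch (any `p`): `ρ̄_{E,p} ≅ Ind_M χ̄` with `p` SPLIT in `M` and `M`
unramified at the good primes (KERNEL, unconditional).**  For an X9 pair `(W, p)`
(`Rank1Residual.ClassX9`), a frame `(Φ, e)` of `E[p]` and a split Cartan subgroup
`C = P (* 0; 0 *) P⁻¹` normalised by the image `G = Φ(ρ̄(Γ_ℚ))` with `G ⊄ C` — verbatim the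
hypothesis of the registered stub `stub_dihedral_noCM` —, the subgroup `U = ρ̄⁻¹(Φ⁻¹(C))` of `Γ_ℚ`
is open, has index `2`, contains the decomposition group `D_𝔓` of every prime `𝔓` of `ℤ̄` above `p`
and the inertia group of every prime above a prime of good reduction.  Proof: `[N(C) : C] = 2` and
`G ⊄ C` give the index (`index_comap_cartan_eq_two`); `U` is the preimage of a subgroup under a
continuous map to a discrete group (`isOpen_comap_cartan`); at `p`, the image of `I_𝔓` is a split
half-Cartan subgroup (Serre §1.11, order prime to `p` by Prop. 15) pinned inside `C` by Prop. 14 and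
normalised by `D_𝔓` (`ClassX9.stabilizer_le_comap_splitCartan`), and `I_𝔓 ≤ D_𝔓`; at a good
`q ≠ p`, `E[p]` is unramified (`inertia_le_comap_cartan`).
[cite: Serre1972, §1.11 Cor. to Prop. 11; §2.2 Prop. 14; §4.2 c) Lemme 2] -/
theorem ClassX9.index_two_subgroup_split_of_splitCartan_normalizer (h : ClassX9 W p)
    {P : GL (Fin 2) (ZMod p)}
    (hGN : (galoisRepTorsion W p).range.map Φ.toMonoidHom ≤
      Subgroup.normalizer (splitCartan P : Set (GL (Fin 2) (ZMod p))))
    (hGC : ¬ (galoisRepTorsion W p).range.map Φ.toMonoidHom ≤ splitCartan P) :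
    IsOpen ((((splitCartan P).comap Φ.toMonoidHom).comap (galoisRepTorsion W p) :
        Subgroup (absoluteGaloisGroup ℚ)) : Set (absoluteGaloisGroup ℚ)) ∧
      (((splitCartan P).comap Φ.toMonoidHom).comap (galoisRepTorsion W p)).index = 2 ∧
      (∀ v : HeightOneSpectrum (𝓞 ℚ), (Rat.HeightOneSpectrum.primesEquiv v : ℕ) = p →
        ∀ 𝔓 ∈ v.primesAbove, 𝔓.decompositionSubgroup (absoluteGaloisGroup ℚ) ≤
          ((splitCartan P).comap Φ.toMonoidHom).comap (galoisRepTorsion W p)) ∧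
      (∀ (q : ℕ) [Fact q.Prime], W.HasGoodReductionAtPrime q →
        ∀ v : HeightOneSpectrum (𝓞 ℚ), (Rat.HeightOneSpectrum.primesEquiv v : ℕ) = q →
        ∀ 𝔔 ∈ v.primesAbove,
          𝔔.inertia (absoluteGaloisGroup ℚ) ≤
            ((splitCartan P).comap Φ.toMonoidHom).comap (galoisRepTorsion W p)) := by
  have hc := classX9_census_of_classX9 W p h
  have h5 : 5 ≤ p := hc.2.2.1
  have hp2 : (∃ P' : GL (Fin 2) (ZMod p), splitCartan P = splitCartan P') → p ≠ 2 :=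
    fun _ ↦ by omega
  have hdec : ∀ v : HeightOneSpectrum (𝓞 ℚ), (Rat.HeightOneSpectrum.primesEquiv v : ℕ) = p →
      ∀ 𝔓 ∈ v.primesAbove, 𝔓.decompositionSubgroup (absoluteGaloisGroup ℚ) ≤
        ((splitCartan P).comap Φ.toMonoidHom).comap (galoisRepTorsion W p) :=
    fun v hv 𝔓 h𝔓 ↦
      Literature.NumberTheory.EllipticCurves.Rank1Residual.ClassX9.stabilizer_le_comap_splitCartan
        W p Φ e he hc hGN hv h𝔓
  refine ⟨isOpen_comap_cartan W p Φ,
    index_comap_cartan_eq_two W p Φ (splitCartan_mem_cartanSubgroups P) hp2 hGN hGC, hdec, ?_⟩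
  intro q _ hgood v hv 𝔔 h𝔔
  by_cases hqp : q = p
  · subst hqp
    exact (Ideal.inertia_le_decompositionSubgroup _ _).trans (hdec v hv 𝔔 h𝔔)
  · exact inertia_le_comap_cartan W p Φ hqp hgood hv h𝔔

end ClassLevel

/-- **The `p = 5` instance** (image type `5Ns`): for an X9 pair `(W, 5)` whose image normalises
the split Cartan subgroup `P (* 0; 0 *) P⁻¹ ≤ GL₂(𝔽₅)` without lying in it, `ρ̄_{E,5} ≅ Ind_M χ̄`
for the quadratic field `M` of `U = ρ̄⁻¹(Φ⁻¹(P (* 0; 0 *) P⁻¹))` (index `2`, open), `5` splits in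
`M`, and `M` is unramified at every good prime.
[cite: Serre1972, §1.11 Cor. to Prop. 11; §2.2 Prop. 14] -/
theorem ClassX9.index_two_subgroup_split_of_splitCartan_normalizer_five
    (W : WeierstrassCurve ℚ) [W.IsElliptic] [W.IsGloballyMinimal] [Fact (Nat.Prime 5)]
    (Φ : Multiplicative (AddAut (geomTorsion W 5)) ≃* GL (Fin 2) (ZMod 5))
    (e : geomTorsion W 5 ≃+ (Fin 2 → ZMod 5))
    (he : ∀ (g : Multiplicative (AddAut (geomTorsion W 5))) (x : geomTorsion W 5),
      e (Multiplicative.toAdd g x) =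
        ((Φ g : GL (Fin 2) (ZMod 5)) : Matrix (Fin 2) (Fin 2) (ZMod 5)) *ᵥ e x)
    (h : ClassX9 W 5) {P : GL (Fin 2) (ZMod 5)}
    (hGN : (galoisRepTorsion W 5).range.map Φ.toMonoidHom ≤
      Subgroup.normalizer (splitCartan P : Set (GL (Fin 2) (ZMod 5))))
    (hGC : ¬ (galoisRepTorsion W 5).range.map Φ.toMonoidHom ≤ splitCartan P) :
    IsOpen ((((splitCartan P).comap Φ.toMonoidHom).comap (galoisRepTorsion W 5) :
        Subgroup (absoluteGaloisGroup ℚ)) : Set (absoluteGaloisGroup ℚ)) ∧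
      (((splitCartan P).comap Φ.toMonoidHom).comap (galoisRepTorsion W 5)).index = 2 ∧
      (∀ v : HeightOneSpectrum (𝓞 ℚ), (Rat.HeightOneSpectrum.primesEquiv v : ℕ) = 5 →
        ∀ 𝔓 ∈ v.primesAbove, 𝔓.decompositionSubgroup (absoluteGaloisGroup ℚ) ≤
          ((splitCartan P).comap Φ.toMonoidHom).comap (galoisRepTorsion W 5)) ∧
      (∀ (q : ℕ) [Fact q.Prime], W.HasGoodReductionAtPrime q →
        ∀ v : HeightOneSpectrum (𝓞 ℚ), (Rat.HeightOneSpectrum.primesEquiv v : ℕ) = q →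
        ∀ 𝔔 ∈ v.primesAbove,
          𝔔.inertia (absoluteGaloisGroup ℚ) ≤
            ((splitCartan P).comap Φ.toMonoidHom).comap (galoisRepTorsion W 5)) :=
  ClassX9.index_two_subgroup_split_of_splitCartan_normalizer W 5 Φ e he h hGN hGC

end Summit.BirchSwinnertonDyer.BirchSwinnertonDyer.Rank1Residual

end
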